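import Literature.AlgebraicGeometry.ModuliOfAbelianVarieties.SiegelUniversalFamilyPieceEndomorphism
import Literature.AlgebraicGeometry.ModuliOfAbelianVarieties.SiegelAdelicMarkingChartRecipeReading
import HarnessLib

/-!
# The per-piece endomorphism READS the integral matrix through THE admissible marking of every fibre — the `Reads`-clause of the E6 closer on a piece
# ([BirkenhakeLange2004] §1.2 Prop. 1.2.1; [Milne2005ShimuraVarieties] §6 Thm. 6.11; [Lange2023AbelianVarietiesComplex] §3.4)

Topic `Literature/AlgebraicGeometry/ModuliOfAbelianVarieties`; namespace `Literature.AlgebraicGeometry.ModuliOfAbelianVarieties`.  THEOREMS ONLY (no definition, no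
named fact, no instance, no notation, no `sorry`).  Cell `hodgecm-mathlib` (D-0151), FLOOR 0, P6 «MOD» (crux hLiu418 = stmt-HodgeConjecture-24832, `--supports`), organ
**PIECES** of the E6 closer of `Cruxes/HLiu418/Lines/F0_P6a_PELWitnessE.lean` (socket Σ-AN `ReadsCReading`; E6 heir A-p06 (g33)): the composite of A-p04 (g24)'s ★ COV-6
`exists_isMonHom_of_piece_readings` (p847522; hypotheses copied TOKEN FOR TOKEN) with ★ RD-P `SiegelAdelicMarking.map_fibreHom_toFun_eq_of_chartRecipe` (p847570): the
per-piece endomorphism `Y` of the pulled-back universal family READS `A` through the admissible marking of EVERY fibre over the piece, for EVERY principal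
representative — the shape of the closer's `Reads`∕`ReadsCReading` clause at the piece fibres (what is then moved to the record curve by ★ RD-T3 and glued by ★ ASM).
HC_CM is proved only modulo the printed citations (2 remaining named inputs hLiu418 24832, h413 24833) until rung 0 closes; this file is generic and changes no count.

THE MATHEMATICS.  With the data of ★ COV-6 (a uniformised Siegel piece with its (U3) junction, a disc quotient `T` over it with holomorphic Siegel lift `Z`,
analytifications, an integral `A` that is `ℂ`-linear at every cone vector and commutes with the monodromy), ★ COV-6 gives charts `(U, σ, Φ, ex)` with (ADM)
markings and an endomorphism `Y` with the chart recipe `φA (ex i (t, C i t z)) = φA (ex i (t, z)) ≫ Y`; ★ RD-P reads the recipe through the marking: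
`Y_{φT t} (m τ) = m (ρ(A) τ)`.  Hence (§1): ONE homomorphism `Y` of `P_T.A` such that at EVERY analytic point `t`, for EVERY principal `(u, r)`, there is an
(ADM)-package `(m, Θ, Λ)` of `P_T` at `φT t` for `(Z (σ t t), r)` with `γ = 1`, `Ψ = Π_{Z (σ t t)}`, `σ t t` a cone vector over `φT t`, through which `Y` reads `A`.

* §1 **`exists_isMonHom_reads_of_piece`** — THE HEAD (hypotheses = ★ COV-6's, verbatim).

## References
* [BirkenhakeLange2004] C. Birkenhake, H. Lange, *Complex Abelian Varieties*, 2nd ed. (2004), §1.2 Proposition 1.2.1.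
* [Milne2005ShimuraVarieties] J. S. Milne, *Introduction to Shimura Varieties* (2005; rev. 2017), §6 Thm. 6.11 pp. 74–75.
* [Lange2023AbelianVarietiesComplex] H. Lange, *Abelian Varieties over the Complex Numbers* (2023), Prop. 3.4.1 p. 186, Lemma 3.4.7 and Prop. 3.4.8 pp. 189–191.
-/

set_option autoImplicit false

noncomputable section

open CategoryTheory CategoryTheory.Limits AlgebraicGeometry Matrix Topology
open scoped Manifold ContDiff Matrix.Norms.Elementwise
open Literature.AlgebraicGeometry.Motives (SchemeOver ComplexPoints AlgPoints specOver AbelianVariety CartierDivisor IsSmoothProjective)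
open Literature.AlgebraicGeometry.AbelianSchemes (PolarizedAbelianSchemeWithLevel AbelianSchemeOver)
open Literature.AlgebraicGeometry.AbelianSchemes.AbelianSchemeOver (fibreHom)
open Literature.AlgebraicGeometry.ShimuraVarieties (UnitaryBallUniformisationDatum negCone isOpen_negCone)
open Literature.Geometry.Kaehler (ComplexTorus)
open Literature.Geometry.Kaehler.ComplexTorus (cover)
open Literature.Geometry.ComplexAnalytic (IsRelExpChartOn totalOver basePoint)
open Literature.NumberTheory.Transcendental (IsAnalytification)
open Literature.NumberTheory.Automorphic (siegelUpperHalfSpace)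
open Literature.NumberTheory.Adeles (latticeOfGL)
open scoped MonObj

namespace Literature.AlgebraicGeometry.ModuliOfAbelianVarieties

open SiegelModuli (jOfSiegel)

/-- **THE PER-PIECE ENDOMORPHISM READS `A` THROUGH THE ADMISSIBLE MARKING OF EVERY FIBRE** (★ COV-6 + ★ RD-P): under the hypotheses of ★ COV-6
`exists_isMonHom_of_piece_readings` (verbatim), there is a homomorphism `Y : P_T.A → P_T.A` of the pulled-back universal family over the piece `T` such that for
EVERY analytic point `t` of `T` there is a cone vector `v` over it (`B.unif v = φT t`) such that for EVERY principal representative `(u, r)` of the piece index `c`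
there is an (ADM)-package `(m, Θ, Λ)` of `P_T` at `φT t` for `(Z v, r)` with `m.γ = 1`, `m.Ψ = Π_{Z v}`, THROUGH WHICH `Y` READS `A`:
`Y_{φT t} (m τ) = m (ρ(A) τ)` — the `Reads`-clause of the E6 closer at the piece fibres.
[cite: BirkenhakeLange2004, §1.2 Proposition 1.2.1] [cite: Milne2005ShimuraVarieties, §6 Thm. 6.11 pp. 74–75]
[cite: Lange2023AbelianVarietiesComplex, Prop. 3.4.1 p. 186 + Lemma 3.4.7 + Prop. 3.4.8 pp. 189–191 + Ex. 3.4.5 (7) p. 191 (universality); cf. Thm. 3.1.2 p. 163] -/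
theorem exists_isMonHom_reads_of_piece (hP3 : siegelUniversalFamilyUniformisation)
    (g N : ℕ) (δ : Fin g → ℕ) (hg : 0 < g) (hδ : IsPolarizationType δ) (hN : 3 ≤ N) (𝓜 : SiegelFineModuliScheme g N δ)
    -- a piece of `𝓜 ⊗ ℂ` with its uniformisation, satisfying the (U2+) clauses of ★ `siegelModuli_complexUniformisation`
    (c : (ZMod N)ˣ) (Sc : SchemeOver ℂ) (ιc : Sc ⟶ (Motives.baseChange ℚ ℂ).obj 𝓜.M)
    (unif : Matrix (Fin g) (Fin g) ℂ → ComplexPoints Sc)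
    (unif_cont : ContinuousOn unif (siegelUpperHalfSpace g)) (unif_open : IsOpenMap ((siegelUpperHalfSpace g).restrict unif))
    (unif_surj : Set.SurjOn unif (siegelUpperHalfSpace g) Set.univ)
    (unif_iff : ∀ Z ∈ siegelUpperHalfSpace g, ∀ Z' ∈ siegelUpperHalfSpace g,
      unif Z = unif Z' ↔ ∃ M ∈ siegelLevelGroup δ N, ∃ C : (Fin g → ℂ) ≃ₗ[ℂ] (Fin g → ℂ),
        ∀ v : Fin g ⊕ Fin g → ℝ, C (siegelPeriodMap δ Z v) = siegelPeriodMap δ Z' (intAct M v))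
    (unif_hol : ∀ (V : Sc.left.affineOpens) (f : Sc.left.presheaf.obj (Opposite.op (↑V : Sc.left.Opens))),
      DifferentiableOn ℂ (fun Z ↦ AlgPoints.evalOrZero (↑V : Sc.left.Opens) f (unif Z))
        (siegelUpperHalfSpace g ∩ unif ⁻¹' {P | P.pt ∈ (↑V : Sc.left.Opens)}))
    -- the (U3) junction for this piece: fibre identification (U3∃) and classification (U3-D3) at every `Z ∈ 𝔥_g`
    (junction : ∀ (u : finAdeleQˣ) (r : gspFinAdelic δ),
      (∀ v, Valued.v ((u : finAdeleQ) v) = 1) →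
      (u : finAdeleQ) - ((c : ZMod N).val : ℕ) ∈ levelIdeal N →
      r ∈ principalLevelSubgroup δ 1 →
      IsMultiplier (typeFormOver δ finAdeleQ) (r : GL (Fin g ⊕ Fin g) finAdeleQ) u →
      ((r : GL (Fin g ⊕ Fin g) finAdeleQ) : Matrix (Fin g ⊕ Fin g) (Fin g ⊕ Fin g) finAdeleQ) =
        Matrix.fromBlocks 1 0 0 ((u : finAdeleQ) • (1 : Matrix (Fin g) (Fin g) finAdeleQ)) →
      ∀ (Z : Matrix (Fin g) (Fin g) ℂ) (hZ : Z ∈ siegelUpperHalfSpace g),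
        haveI : IsLocallyNoetherian (specOver ℚ ℂ).left :=
          inferInstanceAs (IsLocallyNoetherian (Spec (CommRingCat.of ℂ)))
        (∃ (P' : PolarizedAbelianSchemeWithLevel g N δ (specOver ℚ ℂ).left)
            (G : P'.A.X.left ⟶ 𝓜.univ.A.X.left) (Ĝ : P'.D.hat.X.left ⟶ 𝓜.univ.D.hat.X.left),
            P'.IsBaseChangeVia 𝓜.univ
                ((AlgPoints.baseChangeEquiv (algebraMap ℚ ℂ) 𝓜.M).symm (AlgPoints.map ιc (unif Z))).left G Ĝ ∧
            IsAdmissibleAt hδ r Z hZ P') ∧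
        (∀ (P' : PolarizedAbelianSchemeWithLevel g N δ (specOver ℚ ℂ).left), IsAdmissibleAt hδ r Z hZ P' →
            AlgPoints.map ιc (unif Z)
              = AlgPoints.baseChangeEquiv (algebraMap ℚ ℂ) 𝓜.M (𝓜.classifyingMap (specOver ℚ ℂ) P')))
    -- the piece: a compact disc quotient `T` over the Siegel piece, and its slice morphism
    (T : SchemeOver ℂ) (B : UnitaryBallUniformisationDatum 1 T) {Jc : Matrix (Fin 2) (Fin 2) ℂ} (hB : B.Hℂ = Jc) (ψ : T ⟶ Sc)
    -- the holomorphic Siegel lift of `ψ` on the negative cone (★ E6-fac clause 1)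
    (Z : (Fin 2 → ℂ) → Matrix (Fin g) (Fin g) ℂ) (Z_hol : ∀ i j, DifferentiableOn ℂ (fun v => Z v i j) (negCone Jc))
    (Z_mem : ∀ v, v ∈ negCone Jc → Z v ∈ siegelUpperHalfSpace g)
    (hψ : ∀ v, v ∈ negCone Jc → AlgPoints.map ψ (B.unif v) = unif (Z v))
    -- analytifications of `T` (charts on `ℂ`) and of the total space of the pulled-back abelian scheme
    (MT : Type) [TopologicalSpace MT] [ChartedSpace (Fin 1 → ℂ) MT] [IsManifold 𝓘(ℂ, Fin 1 → ℂ) ω MT]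
    (φT : MT → ComplexPoints T) (hT : IsAnalytification (Fin 1 → ℂ) T 1 φT)
    (MA : Type) [TopologicalSpace MA] [ChartedSpace (Fin (1 + g) → ℂ) MA] [IsManifold 𝓘(ℂ, Fin (1 + g) → ℂ) ω MA]
    (φA : MA → ComplexPoints (totalOver T
      (𝓜.univ.baseChange (ψ.left ≫ ιc.left ≫ pullback.fst 𝓜.M.hom (Spec.map (CommRingCat.ofHom (algebraMap ℚ ℂ))))).A))
    (hA : IsAnalytification (Fin (1 + g) → ℂ) (totalOver T
      (𝓜.univ.baseChange (ψ.left ≫ ιc.left ≫ pullback.fst 𝓜.M.hom (Spec.map (CommRingCat.ofHom (algebraMap ℚ ℂ))))).A) (1 + g) φA)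
    -- the total space of the pulled-back abelian scheme is smooth projective (★ E6-Π in the closer)
    (hTot : IsSmoothProjective (1 + g) (totalOver T
      (𝓜.univ.baseChange (ψ.left ≫ ιc.left ≫ pullback.fst 𝓜.M.hom (Spec.map (CommRingCat.ofHom (algebraMap ℚ ℂ))))).A))
    -- a principal representative `(u, r)` of the piece index `c` (the five (U3) premisses)
    (u : finAdeleQˣ) (r : gspFinAdelic δ) (hu : ∀ v, Valued.v ((u : finAdeleQ) v) = 1)
    (huc : (u : finAdeleQ) - ((c : ZMod N).val : ℕ) ∈ levelIdeal N) (hr : r ∈ principalLevelSubgroup δ 1)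
    (hmult : IsMultiplier (typeFormOver δ finAdeleQ) (r : GL (Fin g ⊕ Fin g) finAdeleQ) u)
    (hrmat : ((r : GL (Fin g ⊕ Fin g) finAdeleQ) : Matrix (Fin g ⊕ Fin g) (Fin g ⊕ Fin g) finAdeleQ) =
      Matrix.fromBlocks 1 0 0 ((u : finAdeleQ) • (1 : Matrix (Fin g) (Fin g) finAdeleQ)))
    -- the integral lattice endomorphism, `ℂ`-linear at every cone vector, commuting with the monodromy
    (A : Matrix (Fin g ⊕ Fin g) (Fin g ⊕ Fin g) ℤ)
    (hK : ∀ v ∈ negCone Jc, ∃ Cv : (Fin g → ℂ) →ₗ[ℂ] (Fin g → ℂ),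
      ∀ w : Fin g ⊕ Fin g → ℝ, Cv (siegelPeriodMap δ (Z v) w) = siegelPeriodMap δ (Z v) ((A.map (Int.cast : ℤ → ℝ)) *ᵥ w))
    (htrans : ∀ v ∈ negCone Jc, ∀ v' ∈ negCone Jc, B.unif v = B.unif v' →
      ∃ M ∈ siegelLevelGroup δ N, ∃ L : (Fin g → ℂ) ≃ₗ[ℂ] (Fin g → ℂ),
        (∀ w : Fin g ⊕ Fin g → ℝ, L (siegelPeriodMap δ (Z v) w) = siegelPeriodMap δ (Z v') (intAct M w)) ∧
        (M : Matrix (Fin g ⊕ Fin g) (Fin g ⊕ Fin g) ℤ) * A = A * (M : Matrix (Fin g ⊕ Fin g) (Fin g ⊕ Fin g) ℤ)) :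
    letI P := 𝓜.univ.baseChange (ψ.left ≫ ιc.left ≫ pullback.fst 𝓜.M.hom (Spec.map (CommRingCat.ofHom (algebraMap ℚ ℂ))))
    ∃ (Y : P.A.X ⟶ P.A.X) (_hY : IsMonHom Y),
      ∀ t : MT, ∃ v : Fin 2 → ℂ, v ∈ negCone Jc ∧ B.unif v = φT t ∧
        ∀ (u' : finAdeleQˣ) (r' : gspFinAdelic δ),
          (∀ w, Valued.v ((u' : finAdeleQ) w) = 1) →
          (u' : finAdeleQ) - ((c : ZMod N).val : ℕ) ∈ levelIdeal N →
          r' ∈ principalLevelSubgroup δ 1 →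
          IsMultiplier (typeFormOver δ finAdeleQ) (r' : GL (Fin g ⊕ Fin g) finAdeleQ) u' →
          ((r' : GL (Fin g ⊕ Fin g) finAdeleQ) : Matrix (Fin g ⊕ Fin g) (Fin g ⊕ Fin g) finAdeleQ) =
            Matrix.fromBlocks 1 0 0 ((u' : finAdeleQ) • (1 : Matrix (Fin g) (Fin g) finAdeleQ)) →
          ∃ (hZv : Z v ∈ siegelUpperHalfSpace g)
            (m : SiegelAdelicMarking ⟨jOfSiegel δ (Z v), SiegelComplexRecordSystem.jOfSiegel_mem_C0pm hδ.1 hZv⟩ r'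
              (P.A.fibre (φT t).left).toAbelianVariety)
            (Θ : CartierDivisor (P.A.fibre (φT t).left).toAbelianVariety.X.left)
            (Λ : P.level.SymplecticLift (φT t).left Θ δ),
            Θ.IsAmple ∧ P.A.IsLambdaOfAt (φT t).left P.D P.pol.lam Θ ∧
            (∀ ⦃M : ℕ⦄, N ∣ M → M ≠ 0 → ∀ (x : Fin g ⊕ Fin g → ZMod M) (w : Fin g ⊕ Fin g → ℚ),
              AdelicCongr ((r'⁻¹ : gspFinAdelic δ) : GL (Fin g ⊕ Fin g) finAdeleQ) 1 w (fun i => ((x i).val : ℚ) / M) →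
                ((Λ.lift M (Multiplicative.ofAdd x)) : (P.A.fibre (φT t).left).toAbelianVariety.Points ℂ) = m.r w) ∧
            m.γ = 1 ∧ (∀ w : Fin g ⊕ Fin g → ℝ, m.Ψ w = siegelPeriodMap δ (Z v) w) ∧
            ∀ τ : ComplexTorus m.Ψ,
              AlgPoints.map (fibreHom Y (φT t).left).hom.hom.hom (m.toFun τ) = m.toFun (ComplexTorus.mapMatrix m.Ψ m.Ψ A τ) := by
  obtain ⟨U, σ, Φ, ex, C, Y, hUo, hiU, hσ, hσd, hΦ, hex, hG, hADM, hC, hY, hrec⟩ :=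
    exists_isMonHom_of_piece_readings hP3 g N δ hg hδ hN 𝓜 c Sc ιc unif unif_cont unif_open unif_surj unif_iff unif_hol junction T B hB ψ
      Z Z_hol Z_mem hψ MT φT hT MA φA hA hTot u r hu huc hr hmult hrmat A hK htrans
  haveI := hY
  refine ⟨Y, hY, fun t => ⟨σ t t, (hσ t t (hiU t)).1, (hσ t t (hiU t)).2, fun u' r' hu' huc' hr' hmult' hrmat' => ?_⟩⟩
  obtain ⟨hZt, m, Θ, Λ, hample, hlam, htower, hγ, hΨ, hread⟩ := hADM t u' r' hu' huc' hr' hmult' hrmat' t (hiU t)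
  refine ⟨hZt, m, Θ, Λ, hample, hlam, htower, hγ, hΨ, fun τ => ?_⟩
  refine SiegelAdelicMarking.map_fibreHom_toFun_eq_of_chartRecipe _ φA m (fun z => ex t (t, z))
    (fun z => (hread z)) Y (fun z => C t t z) (fun z => hrec t t (hiU t) z) A (fun w => ?_) τ
  rw [hΨ w, hC t t (hiU t) w, hΨ]

end Literature.AlgebraicGeometry.ModuliOfAbelianVarieties

end
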